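import Summits.ResolutionOfSingularities.ResolutionOfSingularities.Theorems.FrobeniusLadderFInjectiveMacaulayficationSigma7Lx6q7PointFloorRowUncond
import Summits.ResolutionOfSingularities.ResolutionOfSingularities.Theorems.FrobeniusLadderFInjectiveMacaulayficationF108ClassRowAnyField
import Mathlib.FieldTheory.IsAlgClosed.AlgebraicClosure
import HarnessLib

/-!
# GAP-2 «k ≠ k̄»: THE CENSUS BED d4lx6q7 `z² + x⁶z + y³ + u³ + t⁷` (σ₇-shifted) — POINT-FLOOR ROW AND GERM OVER ANY FIELD OF CHARACTERISTIC 2 (any-field twins of ✓ `…Sigma7Lx6q7PointFloorRowUncond`)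
# (crux `FInjectiveMacaulayfication` stmt-ResolutionOfSingularities-15315, chain w45a; seat res-L1-w45a-stub-2 g12; res-L1-w45a-plan-1 GO 2026-08-29T02:44:48Z
# «the H_F class level over EVERY field of characteristic p … then thin any-field rows per census bed»)

[OURS · L1 W4.5a] Support file (`--supports stmt-ResolutionOfSingularities-15315 --as helper`); def-free, unconditional; replaces the role of NO printed item; NOT a statement
of the manuscript; AI-written (AI review is weaker than expert review). OURS counted 0; nothing of the crux is proved.

Every theorem of ✓ `…Sigma7Lx6q7PointFloorRowUncond` that carried `[IsAlgClosed k]` is re-proved here WITHOUT it, for EVERY field `k` of characteristic 2: the callees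
`FHalfRowOfNewtonNondegenerate.*` / `F108ClassRow.*_of_convenient*` (k = k̄) are swapped for this seat's any-field twins `FHalfRowAnyField.*_of_geomWeaklyNondegenerate` /
`F108ClassRowAnyField.*_of_convenient_anyField*` (✓ `…FHalfRowOfWeaklyNondegenerateAnyField`, ✓ `…F108ClassRowAnyField`), whose one changed hypothesis — GEOMETRIC weak
non-degeneracy, i.e. weak non-degeneracy of `map (algebraMap k K) f` over an algebraically closed `K ⊇ k` — is supplied by the bed's field-general Specimen lemma
`Sigma7Lx6q7Specimen.weaklyNondegenerate` at `K := AlgebraicClosure k` (`geom_weaklyNondegenerate`). The field-general lemmas of the original file (strict transforms, shift identity,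
convenience, input side LEGAL / NOT FULL) are imported, not restated. Proof texts are otherwise the originals byte-for-byte.
SCOPE (desk caveat, binding): the vertex is the `k`-RATIONAL origin; closed points with residue field a proper extension of `k` are not addressed (GAP-2).
[OURS · thin application of landed theorems] [cite: IshiiSingularities2018, Thm. 4.4.23; Fedder1983, Thm. 1.12; StacksProject, Tag 080A; GortzWedhorn2020, Prop. 13.91 (2), (13.19)]
-/

-- single-problem summit: the doubled namespace component is forced
set_option linter.dupNamespace false

noncomputable section

open AlgebraicGeometry CategoryTheory Literature.AlgebraicGeometry.Resolution TopologicalSpace IsLocalRing MvPolynomial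

namespace Summit.ResolutionOfSingularities.ResolutionOfSingularities.Theorems.FInjectiveMacaulayfication.Sigma7Lx6q7PointFloorRowAnyField

open Summit.ResolutionOfSingularities.ResolutionOfSingularities.Theorems.FInjectiveMacaulayfication
open SliceableCentre GermForm
open Literature.AlgebraicGeometry.Resolution.BoubakriGreuelMarkwig Sigma7Lx6q7PointFloorRowUncond

/-- **GEOMETRIC weak non-degeneracy of the (shifted) bed over ANY field of characteristic 2**: the Specimen lemma `Sigma7Lx6q7Specimen.weaklyNondegenerate`, stated for every field of
characteristic 2, applied over `AlgebraicClosure k` to `map (algebraMap k _) f` (which is the same polynomial expression). [OURS · plumbing] -/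
theorem geom_weaklyNondegenerate (k : Type) [Field k] [CharP k 2] (f : MvPolynomial (Fin 5) k)
    (hf : f = X 4 ^ 2 + X 0 ^ 6 * X 4 + X 0 ^ 13 + X 0 ^ 14 + X 1 ^ 3 + X 2 ^ 3 + X 3 ^ 7) :
    ∀ w : Fin 5 → ℝ, (∀ i, 0 < w i) →
      IsWeaklyNondegenerateAlong w ((map (algebraMap k (AlgebraicClosure k)) f : MvPolynomial (Fin 5) (AlgebraicClosure k)) :
        MvPowerSeries (Fin 5) (AlgebraicClosure k)) := by
  haveI : CharP (AlgebraicClosure k) 2 := charP_of_injective_algebraMap (algebraMap k (AlgebraicClosure k)).injective 2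
  refine Sigma7Lx6q7Specimen.weaklyNondegenerate (AlgebraicClosure k) _ ?_
  subst hf
  simp


/-- ANY-FIELD TWIN (GAP-2 «k ≠ k̄»; `[IsAlgClosed k]` dropped, geometric weak non-degeneracy via `AlgebraicClosure k`): ★★ **THE POINT-FLOOR ROW OF d4lx6q7 `z² + x⁶z + y³ + u³ + t⁷` (char 2, `k` ANY field) — LEGAL ∧ NOT F(4)-iso ∧ CURED, UNCONDITIONALLY**: one term on
✓ p688090 `F108ClassRow.pointFloorRow_of_convenient_of_ringEquiv` (σ₇ from `PolyAutRowTransport.exists_translate`; hypotheses from `Sigma7Lx6q7Specimen` / `Sigma7Lx6q7PointFloor`: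
prime, convenient, weakly non-degenerate, x̄ᵢ ≠ 0, regular off the vertex, θ-charts, Fedder witness at the x-chart origin, vertex singular). The statement of ✓ p647707
`Lx6q7PointFloorRow.f4pos_row_four` over `k` ANY field, by the class route without cover data. [OURS · thin application; cite: IshiiSingularities2018, Thm. 4.4.23; Fedder1983, Thm. 1.12; GortzWedhorn2020, (13.19)] -/
theorem pointFloorRow_lx6q7_anyField (k : Type) [Field k] [CharP k 2] (f : MvPolynomial (Fin 5) k)
    (hf : f = X 4 ^ 2 + X 0 ^ 6 * X 4 + X 1 ^ 3 + X 2 ^ 3 + X 3 ^ 7)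
    (v' : Spec (.of (MvPolynomial (Fin 5) k ⧸ Ideal.span {f})))
    (hv' : v'.asIdeal = Ideal.span (Set.range fun j : Fin 5 => Ideal.Quotient.mk (Ideal.span {f}) (X j)))
    (S' : Scheme.{0}) (g₁ : S' ⟶ Spec ((Spec (.of (MvPolynomial (Fin 5) k ⧸ Ideal.span {f}))).presheaf.stalk v'))
    (hg₁ : IsBlowup g₁ ((affineBlowup.idealSheaf (Ideal.span (Set.range fun j : Fin 5 => Ideal.Quotient.mk (Ideal.span {f}) (X j)))).comap
      ((Spec (.of (MvPolynomial (Fin 5) k ⧸ Ideal.span {f}))).fromSpecStalk v'))) :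
    (((affineBlowup.idealSheaf (Ideal.span (Set.range fun j : Fin 5 => Ideal.Quotient.mk (Ideal.span {f}) (X j)))).comap
        ((Spec (.of (MvPolynomial (Fin 5) k ⧸ Ideal.span {f}))).fromSpecStalk v')) ≠ ⊥ ∧
      ((((affineBlowup.idealSheaf (Ideal.span (Set.range fun j : Fin 5 => Ideal.Quotient.mk (Ideal.span {f}) (X j)))).comap
        ((Spec (.of (MvPolynomial (Fin 5) k ⧸ Ideal.span {f}))).fromSpecStalk v')).support :
          Set (Spec ((Spec (.of (MvPolynomial (Fin 5) k ⧸ Ideal.span {f}))).presheaf.stalk v'))) ⊆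
        (Scheme.regularLocus (Spec ((Spec (.of (MvPolynomial (Fin 5) k ⧸ Ideal.span {f}))).presheaf.stalk v')))ᶜ) ∧
      (∀ s : S', g₁.base s ≠ closedPoint _ → s ∈ Scheme.regularLocus S') ∧ (∀ s : S', CMCl (S'.presheaf.stalk s))) ∧
    (∃ s : S', g₁.base s = closedPoint _ ∧ ¬ FullCl 2 (S'.presheaf.stalk s)) ∧
    (∃ 𝓚 : S'.IdealSheafData, 𝓚 ≠ ⊥ ∧ (∀ s ∈ (𝓚.support : Set S'), g₁.base s = closedPoint _) ∧
      ∀ (S'' : Scheme.{0}) (π : S'' ⟶ S'), IsBlowup π 𝓚 → ∀ s : S'', FullCl 2 (S''.presheaf.stalk s)) := by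
  haveI : Fact (Nat.Prime 2) := ⟨Nat.prime_two⟩
  obtain ⟨φ, hφ, h₁, h₂⟩ := PolyAutRowTransport.exists_translate k (0 : Fin 5) 4 (by decide) (1 : k) 7 (by norm_num)
  exact F108ClassRowAnyField.pointFloorRow_of_convenient_anyField_of_ringEquiv k (AlgebraicClosure k) 2 (by norm_num) φ h₁ h₂ f _ (by rw [hφ]; exact aeval_shift k f hf)
    (Sigma7Lx6q7Specimen.prime_f k _ rfl) (hconv k _ rfl) (geom_weaklyNondegenerate k _ rfl) (Sigma7Lx6q7Specimen.mk_X_ne_zero k _ rfl)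
    (fun x hx => Sigma7Lx6q7Specimen.regular_off_vertex k _ rfl x.asIdeal hx) (fun _ : Fin 5 => 2) _ (Sigma7Lx6q7PointFloor.theta k _ rfl)
    (Sigma7Lx6q7Specimen.f_not_mem_span_X k _ rfl) (Sigma7Lx6q7PointFloor.g_not_mem_span_X k) (Sigma7Lx6q7Specimen.constantCoeff_f k _ rfl) 0
    (Sigma7Lx6q7PointFloor.constantCoeff_g_zero k) (Sigma7Lx6q7PointFloor.g_zero_mem_frobeniusPower k)
    (fun v hv => Sigma7Lx6q7PointFloor.vertex_not_mem_regularLocus k _ rfl v hv) v' hv' S' g₁ hg₁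

/-- ANY-FIELD TWIN (GAP-2 «k ≠ k̄»; `[IsAlgClosed k]` dropped, geometric weak non-degeneracy via `AlgebraicClosure k`): ★ **`FInjectivizationGermAt 2 v` AT THE VERTEX OF d4lx6q7, UNCONDITIONALLY**: the germ of the shifted bed `V(f′)` from `affineBlowup_fullCl_of_convenient` (the centre `A`
contains a pure power of every variable, so `𝔪 ⊆ √I_A` and `I_A ≠ ⊥`) + ✓ `GermOfGlobalBlowup.fInjectivizationGermAt_of_affineBlowup`, transported along `σ₇` by
`PolyAutRowTransport.fInjectivizationGermAt_of_algEquiv`. [OURS · thin application; cite: GortzWedhorn2020, Prop. 13.91 (2), (13.19)] -/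
theorem lx6q7_fInjectivizationGermAt_anyField (k : Type) [Field k] [CharP k 2] (f : MvPolynomial (Fin 5) k)
    (hf : f = X 4 ^ 2 + X 0 ^ 6 * X 4 + X 1 ^ 3 + X 2 ^ 3 + X 3 ^ 7)
    (v' : Spec (.of (MvPolynomial (Fin 5) k ⧸ Ideal.span {f})))
    (hv' : v'.asIdeal = Ideal.span (Set.range fun j : Fin 5 => Ideal.Quotient.mk (Ideal.span {f}) (X j))) :
    FInjectivizationGermAt 2 v' := by
  classical
  haveI : Fact (Nat.Prime 2) := ⟨Nat.prime_two⟩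
  -- the germ of the shifted bed `V(f′)` at its vertex
  have hshift : ∀ (f' : MvPolynomial (Fin 5) k), f' = X 4 ^ 2 + X 0 ^ 6 * X 4 + X 0 ^ 13 + X 0 ^ 14 + X 1 ^ 3 + X 2 ^ 3 + X 3 ^ 7 →
      ∀ v : Spec (.of (MvPolynomial (Fin 5) k ⧸ Ideal.span {f'})),
        v.asIdeal = Ideal.span (Set.range fun j : Fin 5 => Ideal.Quotient.mk (Ideal.span {f'}) (X j)) → FInjectivizationGermAt 2 v := by
    intro f' hf' v hv
    haveI hp : (Ideal.span {f'}).IsPrime := Sigma7Lx6q7Specimen.isPrime_span_f k f' hf'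
    haveI : IsDomain (MvPolynomial (Fin 5) k ⧸ Ideal.span {f'}) := Ideal.Quotient.isDomain _
    obtain ⟨A, hprim, hfull⟩ := F108ClassRowAnyField.affineBlowup_fullCl_of_convenient_anyField k (AlgebraicClosure k) 2 f' (Sigma7Lx6q7Specimen.prime_f k f' hf') (hconv k f' hf')
      (geom_weaklyNondegenerate k f' hf') (Sigma7Lx6q7Specimen.mk_X_ne_zero k f' hf') (fun x hx => Sigma7Lx6q7Specimen.regular_off_vertex k f' hf' x.asIdeal hx)
    have hpow : ∀ j : Fin 5, ∃ N : ℕ, (Ideal.Quotient.mk (Ideal.span {f'}) (X j)) ^ N ∈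
        Ideal.span ((fun e : Fin 5 →₀ ℕ => Ideal.Quotient.mk (Ideal.span {f'}) (monomial e (1 : k))) '' (A : Set (Fin 5 →₀ ℕ))) := by
      intro j
      obtain ⟨N, hN⟩ := hprim j (Finset.mem_univ j)
      refine ⟨N, ?_⟩
      have e : (Ideal.Quotient.mk (Ideal.span {f'}) (X j)) ^ N = Ideal.Quotient.mk (Ideal.span {f'}) (monomial (Finsupp.single j N) (1 : k)) := by
        rw [← map_pow, X_pow_eq_monomial]
      rw [e]
      exact Ideal.subset_span ⟨_, Finset.mem_coe.mpr hN, rfl⟩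
    refine GermOfGlobalBlowup.fInjectivizationGermAt_of_affineBlowup 2 _ ?_ v ?_ hfull
    · obtain ⟨N, hN⟩ := hpow 0
      intro hbot
      rw [hbot, Ideal.mem_bot] at hN
      exact pow_ne_zero N (Sigma7Lx6q7Specimen.mk_X_ne_zero k f' hf' 0) hN
    · rw [hv, Ideal.span_le]
      rintro _ ⟨j, rfl⟩
      obtain ⟨N, hN⟩ := hpow j
      exact ⟨N, hN⟩
  obtain ⟨φ, hφ, h₁, h₂⟩ := PolyAutRowTransport.exists_translate k (0 : Fin 5) 4 (by decide) (1 : k) 7 (by norm_num)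
  exact PolyAutRowTransport.fInjectivizationGermAt_of_algEquiv k 2 φ h₁ h₂ f _ (by rw [hφ]; exact aeval_shift k f hf)
    (fun v hv => hshift _ rfl v hv) v' hv'

end Summit.ResolutionOfSingularities.ResolutionOfSingularities.Theorems.FInjectiveMacaulayfication.Sigma7Lx6q7PointFloorRowAnyField

end
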